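import Summits.QuantumFields.BalabanUV.Beta.FP.KernelPeriodisationFibHessKerTower

/-!
# `BalabanUV.Beta.FP.KernelPeriodisationFibHessKerTowerWound` — road «FP» (binder row D1), ROUTE T, (T-PER) PART 4‴ **WOUND**: leaf-06's (P2‴)-on-the-tower lemma
# `KernelPeriodisationFibHessKerTower.hessKer_law_of_tower_hessT_law` with the SECOND-ORDER TORUS SLOT of each system an ARBITRARY box-dependent lattice kernel
# `𝒲♭_X : ℕ → MKer` (the WOUND family of SPEC-54 §9 ∕ an2 g67 J-NOTE-7 (R1)) and ONE displayed WINDING LETTER per system — the tadpole trace of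
# `perF T_B (dper T_B (𝒲♭_X B))` and of `perF T_B (dper T_B (𝒲_X μ 0 ν z))` have the same limit (their difference tends to `0`)

WHY (`HOME/b2b-balaban-beta-d1-p3/g42/SPEC-54.md` §9; an2 g67 `gen67/J7-WINDING-OBSTRUCTION.md` v1.1 §4–§5; road CLOSE l.67696 (R1)).  The N-system's exact torus
second-order object at box `B` is NOT the `d = 0` periodisation `perF T (dper T (𝒲 μ y ν y′))` of the lattice family but the periodisation of the WOUND family
`Σ' d, 𝒲 μ y ν (y′ + (Mc B)•d)` (one relative source winding survives the double fold; an2's `CombHId2W2SymSwap.dper_tsum_W2SymOfK_translate` is the same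
phenomenon for the comb chart).  The de-periodisation step needs only: the torus `hessT`-law at every box with THAT slot, the bi-localisation of the `d = 0`
member (as before), and that the extra windings do not move the tadpole limit.  This file is leaf-06's §2 ∕ §4 with exactly that change; the law v-next
`TowerKernelLawNamedC` is ONE term of §2 below over #41d-Sym, as `TowerKernelLawSymB` is one term of leaf-06 §2.
CONTENT ([folklore]; no `def`, no `def … : Prop`, nothing cited, 0 sorry; 0 estimates):
* §1 `hessT_wound_eq` (`hessT L V V′ W♭ = hessT L V V′ W + ½·(tr(L·W♭) − tr(L·W))`, `ring`); **`tendsto_hessT_perF_hessKer_wound`** = (P2‴) §3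
  `tendsto_hessT_perF_hessKer` with the `W`-slot `perF (Mk k) (dper (Mk k) (𝒲♭ k))` and the WINDING LETTER
  `Tendsto (k ↦ tr(perF A · perF (dper (𝒲♭ k))) − tr(perF A · perF (dper (𝒲 μ 0 ν z)))) atTop (𝓝 0)` displayed; same limit `hessKer A 𝒱 𝒲 μ ν z`.
* §2 **`hessKer_law_of_tower_hessT_law_wound`** = leaf-06 §2 with the three `W`-slots wound (`𝒲♭_N 𝒲♭_F : ℕ → MKer` on `towerTorus Lc (M′ k) (n+1)`, `𝒲♭_G` on
  `M′ k`) and three winding letters; **`hessKer_law_of_tower_hessT_law_wound_eventually`** = leaf-06 §4's `∀ᶠ k` form of the same.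
  The UNWOUND case `𝒲♭_X k := 𝒲_X μ 0 ν z` has the letter by `sub_self ∕ tendsto_const_nhds` (`winding_letter_of_unwound`), so leaf-06 §2 is the special case.
What it is NOT: not the DISCHARGE of the winding letter for the copy-sum family (one geometric series per system from far-small bi-localisation — the (C1)
instantiation's ∕ an2's offered lemma, or a road file on GO), not the namings, not #41d.  Moves NO (CONV-C) clause and NO row-D1 binder; NOT (T-ID), NOT SDF,
NOT D1, NOT BetaPertH, NOT continuum, NOT Clay.

HONEST DEPENDENCY (page 1, mandatory): continuum YM on T⁴ ⇐ BetaPertH ∧ nine spine estimates (0/9 proved); BetaPertH ⇐ (D1) ∧ (D4) ∧ CAP+tail;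
G-an2-4 gates asym, D1 and NE2/3/4.  HONEST FRAMING (cell contract, verbatim): «discharging `BetaPertH` makes Bałaban's UV stability UNCONDITIONAL —
a real constructive-QFT result; it is NOT the continuum limit and NOT the Clay problem.»  ABSOLUTE RULE (cell charter, verbatim): «No internally-minted
statement may enter as a cited fact. Every hypothesis is either kernel-proved in this package or a verbatim quotation of a PUBLISHED theorem with page
reference. The manuscript(s) under audit are NOT citable for their own disputed steps — they are the thing under adjudication; programme-internal
(2001/route/tribunal) claims are never citable.»  Nothing of Bałaban's asserted.  Road «FP» OWNER, b2b-balaban-beta-d1-p3 gen 43, 2026-08-27.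
No existing file touched.
-/

noncomputable section

open scoped BigOperators Matrix Topology
open Finset Filter

namespace Summit.QuantumFields.BalabanUV.Beta.FP.KernelPeriodisationFibHessKerTowerWound

open Literature.MathematicalPhysics.QuantumFieldTheory.Balaban1983to89
open Literature.MathematicalPhysics.QuantumFieldTheory.Balaban1983to89.Beta
open B4TorusKernel.MultiPeriod (translate)
open ExpKernelCalculus (MKer Decays BiLoc shiftK hessKer)
open Summit.QuantumFields.BalabanUV.Beta.D1BFx.MixedVarPackedHess (hessT)
open Summit.QuantumFields.BalabanUV.Beta.FP.KernelPeriodisationFib (perF translate_invariant_of_shiftK)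
open Summit.QuantumFields.BalabanUV.Beta.FP.KernelPeriodisationFibLoc (dper)
open Summit.QuantumFields.BalabanUV.Beta.FP.KernelPeriodisationFibHessKer (tendsto_hessT_perF_hessKer)
open Summit.QuantumFields.BalabanUV.Beta.FP.KernelPeriodisationFibHessKerTower (eventually_le_towerTorus translate_invariant_towerTorus_of_shiftK
  translate_invariant_towerTorus_of_shiftK_succ)
open Summit.QuantumFields.BalabanUV.Beta.FP.TorusCompositeObjects (towerTorus)

variable {d : ℕ}

/-! ## §1 The wound `W`-slot: `hessT` splits off the winding difference, and the limit is unchanged under the winding letter -/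

section Wound

variable {F : Type*} [Fintype F]

/-- [folklore] `hessT L V V′ W♭ = hessT L V V′ W + ½·(tr(L·W♭) − tr(L·W))` (the bubble half does not see the second-order slot). -/
theorem hessT_wound_eq {ι : Type*} [Fintype ι] (L V V' W Wb : Matrix ι ι ℝ) :
    hessT L V V' Wb = hessT L V V' W + (1 / 2 : ℝ) * ((L * Wb).trace - (L * W).trace) := by
  unfold hessT; ring

variable {A : MKer (d + 1) F} {CA Cv Cv' Cw α δ : ℝ} {p p' q q' : Fin (d + 1) → ℤ}

/-- [folklore] **`tendsto_hessT_perF_hessKer_wound` — (P2‴) §3 WITH A WOUND SECOND-ORDER SLOT.**  Base-point families `𝒱`, `𝒲` of `ExpKernelCalculus.hessKer`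
(`𝒱 μ 0`, `𝒱 ν z`, `𝒲 μ 0 ν z` bi-localised), an `Mkℤ`-invariant decaying leg `A`, and a box-dependent lattice kernel `𝒲♭ k` in the torus `W`-slot whose
periodised tadpole trace differs from that of `𝒲 μ 0 ν z` by a null sequence (the WINDING LETTER `hWw`); then
`hessT (perF A) (perF (dper (𝒱 μ 0))) (perF (dper (𝒱 ν z))) (perF (dper (𝒲♭ k))) → hessKer A 𝒱 𝒲 μ ν z`. -/
theorem tendsto_hessT_perF_hessKer_wound (Mk : ℕ → (Fin (d + 1) → ℕ)) [∀ k μ, NeZero (Mk k μ)]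
    (hMk : ∀ N : ℕ, ∀ᶠ k in atTop, ∀ i, N ≤ Mk k i) (hA : Decays A CA α) (hα : 0 < α)
    (hAinv : ∀ k (m x y : Fin (d + 1) → ℤ) (a b : F), A (translate (Mk k) x m) (translate (Mk k) y m) a b = A x y a b)
    (𝒱 : Fin (d + 1) → (Fin (d + 1) → ℤ) → MKer (d + 1) F) (𝒲 : Fin (d + 1) → (Fin (d + 1) → ℤ) → Fin (d + 1) → (Fin (d + 1) → ℤ) → MKer (d + 1) F)
    (𝒲b : ℕ → MKer (d + 1) F) (μ ν : Fin (d + 1)) (z : Fin (d + 1) → ℤ)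
    (hV : BiLoc (𝒱 μ 0) p p' Cv δ) (hV' : BiLoc (𝒱 ν z) q' q Cv' δ) (hW : BiLoc (𝒲 μ 0 ν z) p q Cw δ) (hδ : 0 < δ)
    (hWw : Tendsto (fun k => Matrix.trace (perF (Mk k) A * perF (Mk k) (dper (Mk k) (𝒲b k)))
        - Matrix.trace (perF (Mk k) A * perF (Mk k) (dper (Mk k) (𝒲 μ 0 ν z)))) atTop (𝓝 0)) :
    Tendsto (fun k => hessT (perF (Mk k) A) (perF (Mk k) (dper (Mk k) (𝒱 μ 0))) (perF (Mk k) (dper (Mk k) (𝒱 ν z)))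
        (perF (Mk k) (dper (Mk k) (𝒲b k)))) atTop (𝓝 (hessKer A 𝒱 𝒲 μ ν z)) := by
  have h0 := tendsto_hessT_perF_hessKer Mk hMk hA hα hAinv 𝒱 𝒲 μ ν z hV hV' hW hδ
  have h1 := h0.add (hWw.const_mul (1 / 2 : ℝ))
  rw [mul_zero, add_zero] at h1
  refine h1.congr fun k => ?_
  exact (hessT_wound_eq _ _ _ _ _).symm

/-- [folklore] the UNWOUND slot `𝒲♭ k := 𝒲 μ 0 ν z` has the winding letter trivially — leaf-06's (P2‴) §2 is the special case of §2 below. -/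
theorem winding_letter_of_unwound (Mk : ℕ → (Fin (d + 1) → ℕ)) (W : MKer (d + 1) F) :
    Tendsto (fun k => Matrix.trace (perF (Mk k) A * perF (Mk k) (dper (Mk k) W))
        - Matrix.trace (perF (Mk k) A * perF (Mk k) (dper (Mk k) W))) atTop (𝓝 0) := by
  simp only [sub_self]; exact tendsto_const_nhds

end Wound

/-! ## §2 (P2‴) on the tower's boxes with WOUND second-order slots -/

section Law

variable {FN FF FG : Type*} [Fintype FN] [Fintype FF] [Fintype FG]
variable {AN : MKer (d + 1) FN} {AF : MKer (d + 1) FF} {AG : MKer (d + 1) FG}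
  {CAN αN CAF αF CAG αG δN δF δG CvN CvN' CwN CvF CvF' CwF CvG CvG' CwG : ℝ}
  {pN pN' qN qN' pF pF' qF qF' pG pG' qG qG' : Fin (d + 1) → ℤ}

/-- [folklore] **`hessKer_law_of_tower_hessT_law_wound` — (P2‴) ON #41d's BOXES, WOUND SECOND-ORDER SLOTS.**  leaf-06's `hessKer_law_of_tower_hessT_law` VERBATIM
but: each system `X = N, F, G` carries a box-dependent lattice kernel `𝒲♭_X : ℕ → MKer` (the wound family's `(μ,0;ν,z)` member at box `k`), the torus law `hlaw k`
reads `perF · (dper · (𝒲♭_X k))` in its `W`-slots, and ONE WINDING LETTER per system says the periodised tadpole traces of `𝒲♭_X k` and of `𝒲_X μ 0 ν z` differ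
by a null sequence.  THEN `hessKer A_N 𝒱_N 𝒲_N μ ν z = hessKer A_F 𝒱_F 𝒲_F μ ν z + hessKer A_G 𝒱_G 𝒲_G μ ν z` (three `tendsto_hessT_perF_hessKer_wound` +
`tendsto_nhds_unique`). -/
theorem hessKer_law_of_tower_hessT_law_wound (Lc : ℕ) [NeZero Lc] (M' : ℕ → (Fin (d + 1) → ℕ)) [∀ k μ, NeZero (M' k μ)]
    (hM' : ∀ N : ℕ, ∀ᶠ k in atTop, ∀ i, N ≤ M' k i) (hLcM' : ∀ k i, Lc ∣ M' k i) (n : ℕ)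
    (𝒱N : Fin (d + 1) → (Fin (d + 1) → ℤ) → MKer (d + 1) FN) (𝒱F : Fin (d + 1) → (Fin (d + 1) → ℤ) → MKer (d + 1) FF)
    (𝒱G : Fin (d + 1) → (Fin (d + 1) → ℤ) → MKer (d + 1) FG)
    (𝒲N : Fin (d + 1) → (Fin (d + 1) → ℤ) → Fin (d + 1) → (Fin (d + 1) → ℤ) → MKer (d + 1) FN)
    (𝒲F : Fin (d + 1) → (Fin (d + 1) → ℤ) → Fin (d + 1) → (Fin (d + 1) → ℤ) → MKer (d + 1) FF)
    (𝒲G : Fin (d + 1) → (Fin (d + 1) → ℤ) → Fin (d + 1) → (Fin (d + 1) → ℤ) → MKer (d + 1) FG)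
    (𝒲bN : ℕ → MKer (d + 1) FN) (𝒲bF : ℕ → MKer (d + 1) FF) (𝒲bG : ℕ → MKer (d + 1) FG)
    (μ ν : Fin (d + 1)) (z : Fin (d + 1) → ℤ)
    -- `N`: the depth-`(n+2)` composite one-shot system on `towerTorus Lc (M′ k) (n+1)`, blocking `Lc^{n+2}`; wound slot `𝒲♭_N`
    (hAN : Decays AN CAN αN) (hαN : 0 < αN) (hANsh : ∀ t : Fin (d + 1) → ℤ, shiftK (((Lc ^ (n + 2) : ℕ) : ℤ) • t) AN = AN)
    (hVN : BiLoc (𝒱N μ 0) pN pN' CvN δN) (hVN' : BiLoc (𝒱N ν z) qN' qN CvN' δN) (hWN : BiLoc (𝒲N μ 0 ν z) pN qN CwN δN) (hδN : 0 < δN)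
    (hWNw : Tendsto (fun k => Matrix.trace (perF (towerTorus Lc (M' k) (n + 1)) AN * perF (towerTorus Lc (M' k) (n + 1)) (dper (towerTorus Lc (M' k) (n + 1)) (𝒲bN k)))
        - Matrix.trace (perF (towerTorus Lc (M' k) (n + 1)) AN * perF (towerTorus Lc (M' k) (n + 1)) (dper (towerTorus Lc (M' k) (n + 1)) (𝒲N μ 0 ν z)))) atTop (𝓝 0))
    -- `F`: the depth-`(n+1)` composite one-shot system on the SAME torus, blocking `Lc^{n+1}`; wound slot `𝒲♭_F`
    (hAF : Decays AF CAF αF) (hαF : 0 < αF) (hAFsh : ∀ t : Fin (d + 1) → ℤ, shiftK (((Lc ^ (n + 1) : ℕ) : ℤ) • t) AF = AF)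
    (hVF : BiLoc (𝒱F μ 0) pF pF' CvF δF) (hVF' : BiLoc (𝒱F ν z) qF' qF CvF' δF) (hWF : BiLoc (𝒲F μ 0 ν z) pF qF CwF δF) (hδF : 0 < δF)
    (hWFw : Tendsto (fun k => Matrix.trace (perF (towerTorus Lc (M' k) (n + 1)) AF * perF (towerTorus Lc (M' k) (n + 1)) (dper (towerTorus Lc (M' k) (n + 1)) (𝒲bF k)))
        - Matrix.trace (perF (towerTorus Lc (M' k) (n + 1)) AF * perF (towerTorus Lc (M' k) (n + 1)) (dper (towerTorus Lc (M' k) (n + 1)) (𝒲F μ 0 ν z)))) atTop (𝓝 0))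
    -- `G`: the top step's resolvent on `M′ k`, blocking `Lc`; wound slot `𝒲♭_G`
    (hAG : Decays AG CAG αG) (hαG : 0 < αG) (hAGsh : ∀ t : Fin (d + 1) → ℤ, shiftK ((Lc : ℤ) • t) AG = AG)
    (hVG : BiLoc (𝒱G μ 0) pG pG' CvG δG) (hVG' : BiLoc (𝒱G ν z) qG' qG CvG' δG) (hWG : BiLoc (𝒲G μ 0 ν z) pG qG CwG δG) (hδG : 0 < δG)
    (hWGw : Tendsto (fun k => Matrix.trace (perF (M' k) AG * perF (M' k) (dper (M' k) (𝒲bG k)))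
        - Matrix.trace (perF (M' k) AG * perF (M' k) (dper (M' k) (𝒲G μ 0 ν z)))) atTop (𝓝 0))
    -- #41d's conclusion SHAPE at every box `M′ k`, first jets named `perF · (dper · 𝒱_X …)`, second-order slots WOUND
    (hlaw : ∀ k,
      hessT (perF (towerTorus Lc (M' k) (n + 1)) AN) (perF (towerTorus Lc (M' k) (n + 1)) (dper (towerTorus Lc (M' k) (n + 1)) (𝒱N μ 0)))
          (perF (towerTorus Lc (M' k) (n + 1)) (dper (towerTorus Lc (M' k) (n + 1)) (𝒱N ν z)))
          (perF (towerTorus Lc (M' k) (n + 1)) (dper (towerTorus Lc (M' k) (n + 1)) (𝒲bN k))) =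
        hessT (perF (towerTorus Lc (M' k) (n + 1)) AF) (perF (towerTorus Lc (M' k) (n + 1)) (dper (towerTorus Lc (M' k) (n + 1)) (𝒱F μ 0)))
            (perF (towerTorus Lc (M' k) (n + 1)) (dper (towerTorus Lc (M' k) (n + 1)) (𝒱F ν z)))
            (perF (towerTorus Lc (M' k) (n + 1)) (dper (towerTorus Lc (M' k) (n + 1)) (𝒲bF k))) +
          hessT (perF (M' k) AG) (perF (M' k) (dper (M' k) (𝒱G μ 0))) (perF (M' k) (dper (M' k) (𝒱G ν z)))
            (perF (M' k) (dper (M' k) (𝒲bG k)))) :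
    hessKer AN 𝒱N 𝒲N μ ν z = hessKer AF 𝒱F 𝒲F μ ν z + hessKer AG 𝒱G 𝒲G μ ν z := by
  have hN := tendsto_hessT_perF_hessKer_wound (fun k => towerTorus Lc (M' k) (n + 1))
    (fun N => eventually_le_towerTorus Lc M' hM' (n + 1) N) hAN hαN
    (fun k m x y a b => translate_invariant_towerTorus_of_shiftK_succ (M' k) (hLcM' k) (n + 1) hANsh m x y a b) 𝒱N 𝒲N 𝒲bN μ ν z
    hVN hVN' hWN hδN hWNw
  have hF := tendsto_hessT_perF_hessKer_wound (fun k => towerTorus Lc (M' k) (n + 1))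
    (fun N => eventually_le_towerTorus Lc M' hM' (n + 1) N) hAF hαF
    (fun k m x y a b => translate_invariant_towerTorus_of_shiftK (M' k) (n + 1) hAFsh m x y a b) 𝒱F 𝒲F 𝒲bF μ ν z
    hVF hVF' hWF hδF hWFw
  have hG := tendsto_hessT_perF_hessKer_wound M' hM' hAG hαG
    (fun k m x y a b => translate_invariant_of_shiftK (M' k) hAGsh (hLcM' k) m x y a b) 𝒱G 𝒲G 𝒲bG μ ν z hVG hVG' hWG hδG hWGw
  exact tendsto_nhds_unique (Filter.Tendsto.congr (fun k => (hlaw k)) hN) (hF.add hG)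

/-- [folklore] **`hessKer_law_of_tower_hessT_law_wound_eventually`** — the same with the torus law assumed only for all sufficiently large boxes
(`hlaw : ∀ᶠ k in atTop, …`; leaf-06 §4's form). -/
theorem hessKer_law_of_tower_hessT_law_wound_eventually (Lc : ℕ) [NeZero Lc] (M' : ℕ → (Fin (d + 1) → ℕ)) [∀ k μ, NeZero (M' k μ)]
    (hM' : ∀ N : ℕ, ∀ᶠ k in atTop, ∀ i, N ≤ M' k i) (hLcM' : ∀ k i, Lc ∣ M' k i) (n : ℕ)
    (𝒱N : Fin (d + 1) → (Fin (d + 1) → ℤ) → MKer (d + 1) FN) (𝒱F : Fin (d + 1) → (Fin (d + 1) → ℤ) → MKer (d + 1) FF)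
    (𝒱G : Fin (d + 1) → (Fin (d + 1) → ℤ) → MKer (d + 1) FG)
    (𝒲N : Fin (d + 1) → (Fin (d + 1) → ℤ) → Fin (d + 1) → (Fin (d + 1) → ℤ) → MKer (d + 1) FN)
    (𝒲F : Fin (d + 1) → (Fin (d + 1) → ℤ) → Fin (d + 1) → (Fin (d + 1) → ℤ) → MKer (d + 1) FF)
    (𝒲G : Fin (d + 1) → (Fin (d + 1) → ℤ) → Fin (d + 1) → (Fin (d + 1) → ℤ) → MKer (d + 1) FG)
    (𝒲bN : ℕ → MKer (d + 1) FN) (𝒲bF : ℕ → MKer (d + 1) FF) (𝒲bG : ℕ → MKer (d + 1) FG)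
    (μ ν : Fin (d + 1)) (z : Fin (d + 1) → ℤ)
    (hAN : Decays AN CAN αN) (hαN : 0 < αN) (hANsh : ∀ t : Fin (d + 1) → ℤ, shiftK (((Lc ^ (n + 2) : ℕ) : ℤ) • t) AN = AN)
    (hVN : BiLoc (𝒱N μ 0) pN pN' CvN δN) (hVN' : BiLoc (𝒱N ν z) qN' qN CvN' δN) (hWN : BiLoc (𝒲N μ 0 ν z) pN qN CwN δN) (hδN : 0 < δN)
    (hWNw : Tendsto (fun k => Matrix.trace (perF (towerTorus Lc (M' k) (n + 1)) AN * perF (towerTorus Lc (M' k) (n + 1)) (dper (towerTorus Lc (M' k) (n + 1)) (𝒲bN k)))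
        - Matrix.trace (perF (towerTorus Lc (M' k) (n + 1)) AN * perF (towerTorus Lc (M' k) (n + 1)) (dper (towerTorus Lc (M' k) (n + 1)) (𝒲N μ 0 ν z)))) atTop (𝓝 0))
    (hAF : Decays AF CAF αF) (hαF : 0 < αF) (hAFsh : ∀ t : Fin (d + 1) → ℤ, shiftK (((Lc ^ (n + 1) : ℕ) : ℤ) • t) AF = AF)
    (hVF : BiLoc (𝒱F μ 0) pF pF' CvF δF) (hVF' : BiLoc (𝒱F ν z) qF' qF CvF' δF) (hWF : BiLoc (𝒲F μ 0 ν z) pF qF CwF δF) (hδF : 0 < δF)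
    (hWFw : Tendsto (fun k => Matrix.trace (perF (towerTorus Lc (M' k) (n + 1)) AF * perF (towerTorus Lc (M' k) (n + 1)) (dper (towerTorus Lc (M' k) (n + 1)) (𝒲bF k)))
        - Matrix.trace (perF (towerTorus Lc (M' k) (n + 1)) AF * perF (towerTorus Lc (M' k) (n + 1)) (dper (towerTorus Lc (M' k) (n + 1)) (𝒲F μ 0 ν z)))) atTop (𝓝 0))
    (hAG : Decays AG CAG αG) (hαG : 0 < αG) (hAGsh : ∀ t : Fin (d + 1) → ℤ, shiftK ((Lc : ℤ) • t) AG = AG)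
    (hVG : BiLoc (𝒱G μ 0) pG pG' CvG δG) (hVG' : BiLoc (𝒱G ν z) qG' qG CvG' δG) (hWG : BiLoc (𝒲G μ 0 ν z) pG qG CwG δG) (hδG : 0 < δG)
    (hWGw : Tendsto (fun k => Matrix.trace (perF (M' k) AG * perF (M' k) (dper (M' k) (𝒲bG k)))
        - Matrix.trace (perF (M' k) AG * perF (M' k) (dper (M' k) (𝒲G μ 0 ν z)))) atTop (𝓝 0))
    (hlaw : ∀ᶠ k in atTop,
      hessT (perF (towerTorus Lc (M' k) (n + 1)) AN) (perF (towerTorus Lc (M' k) (n + 1)) (dper (towerTorus Lc (M' k) (n + 1)) (𝒱N μ 0)))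
          (perF (towerTorus Lc (M' k) (n + 1)) (dper (towerTorus Lc (M' k) (n + 1)) (𝒱N ν z)))
          (perF (towerTorus Lc (M' k) (n + 1)) (dper (towerTorus Lc (M' k) (n + 1)) (𝒲bN k))) =
        hessT (perF (towerTorus Lc (M' k) (n + 1)) AF) (perF (towerTorus Lc (M' k) (n + 1)) (dper (towerTorus Lc (M' k) (n + 1)) (𝒱F μ 0)))
            (perF (towerTorus Lc (M' k) (n + 1)) (dper (towerTorus Lc (M' k) (n + 1)) (𝒱F ν z)))
            (perF (towerTorus Lc (M' k) (n + 1)) (dper (towerTorus Lc (M' k) (n + 1)) (𝒲bF k))) +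
          hessT (perF (M' k) AG) (perF (M' k) (dper (M' k) (𝒱G μ 0))) (perF (M' k) (dper (M' k) (𝒱G ν z)))
            (perF (M' k) (dper (M' k) (𝒲bG k)))) :
    hessKer AN 𝒱N 𝒲N μ ν z = hessKer AF 𝒱F 𝒲F μ ν z + hessKer AG 𝒱G 𝒲G μ ν z := by
  have hN := tendsto_hessT_perF_hessKer_wound (fun k => towerTorus Lc (M' k) (n + 1))
    (fun N => eventually_le_towerTorus Lc M' hM' (n + 1) N) hAN hαN
    (fun k m x y a b => translate_invariant_towerTorus_of_shiftK_succ (M' k) (hLcM' k) (n + 1) hANsh m x y a b) 𝒱N 𝒲N 𝒲bN μ ν z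
    hVN hVN' hWN hδN hWNw
  have hF := tendsto_hessT_perF_hessKer_wound (fun k => towerTorus Lc (M' k) (n + 1))
    (fun N => eventually_le_towerTorus Lc M' hM' (n + 1) N) hAF hαF
    (fun k m x y a b => translate_invariant_towerTorus_of_shiftK (M' k) (n + 1) hAFsh m x y a b) 𝒱F 𝒲F 𝒲bF μ ν z
    hVF hVF' hWF hδF hWFw
  have hG := tendsto_hessT_perF_hessKer_wound M' hM' hAG hαG
    (fun k m x y a b => translate_invariant_of_shiftK (M' k) hAGsh (hLcM' k) m x y a b) 𝒱G 𝒲G 𝒲bG μ ν z hVG hVG' hWG hδG hWGw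
  exact tendsto_nhds_unique (Filter.Tendsto.congr' hlaw hN) (hF.add hG)

end Law

end Summit.QuantumFields.BalabanUV.Beta.FP.KernelPeriodisationFibHessKerTowerWound

end
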